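import Summits.KontsevichZagierPeriods.KontsevichZagierPeriods.Theorems.RootDecompWalshStrataPolarChart01

/-!
# The elliptic-polar chart, part 2/5: the `r`-primitive of the pulled-back weight; rational affine maps

Declarations `ph` … `AffMap.inBaker_to` of the farm-checked gen-7 file `PolarChart.lean`: the primitive
`P(t, r) = (γ/(3a))(a r² + c)^{3/2}/(κ₀ + κ₁t²)` of the pulled-back weight `γ r √(a r² + c)/(κ₀ + κ₁t²)`
(`hasDerivAt_ppot_snoc` in the `Fin.snoc` form consumed by `InBaker.of_planar_sections`, `continuous_ppot`,
`isSemialgebraicFunOn_ppot`), and rational affine maps of the plane as one move of rule (2) (`AffMap.sub_mem_relations`,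
`AffMap.inBaker_of`, `AffMap.inBaker_to`, with the explicit inverse `AffMap.inv` and `AffMap.image_toFun`).
See the module docstring of `RootDecompWalshStrataPolarChart01` (part 1). [KontsevichZagier2001 §1.2 rule (2); BCR1998 §2.2; this node gen 7]
-/

noncomputable section

open Set MeasureTheory MvPolynomial Literature.NumberTheory.Transcendental
open Literature.ModelTheory.ExponentialFields (IsSemialgebraic isSemialgebraic_univ)

namespace Summit.KontsevichZagierPeriods.RootDecompWalshStrata.ConicDescent.BallCube

variable {κ₀ κ₁ : ℚ}

/-! #### 32.5 The `r`-primitive of the pulled-back weight (input of `InBaker.of_planar_sections`) -/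

/-- `h(s) = (a s² + c)·√(a s² + c)`, so that `h′ = 3 a s √(a s² + c)` where `a s² + c > 0`.
[this node] -/
def ph (a c : ℚ) (s : ℝ) : ℝ := ((a : ℝ) * s ^ 2 + c) * √(a * s ^ 2 + c)

/-- Auxiliary step `hasDerivAt_lin_sq`. [bookkeeping] -/
theorem hasDerivAt_lin_sq (a c : ℚ) (s : ℝ) :
    HasDerivAt (fun x : ℝ => (a : ℝ) * x ^ 2 + c) (2 * a * s) s := by
  have h := ((hasDerivAt_pow 2 s).const_mul (a : ℝ)).add_const (c : ℝ)
  have e : (2 : ℝ) * a * s = a * (((2 : ℕ) : ℝ) * s ^ (2 - 1)) := by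
    push_cast
    ring
  rw [e]
  exact h

/-- `h′(s) = 3 a s √(a s² + c)` on `a s² + c > 0`. [calculus] -/
theorem hasDerivAt_ph (a c : ℚ) {s : ℝ} (hs : 0 < (a : ℝ) * s ^ 2 + c) :
    HasDerivAt (ph a c) (3 * a * s * √(a * s ^ 2 + c)) s := by
  have hu := hasDerivAt_lin_sq a c s
  have h := hu.mul (hu.sqrt hs.ne')
  have hsu : √((a : ℝ) * s ^ 2 + c) * √(a * s ^ 2 + c) = a * s ^ 2 + c :=
    Real.mul_self_sqrt hs.le
  have hne : √((a : ℝ) * s ^ 2 + c) ≠ 0 := (Real.sqrt_pos.2 hs).ne'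
  have e : 2 * (a : ℝ) * s * √(a * s ^ 2 + c) +
      (a * s ^ 2 + c) * (2 * a * s / (2 * √(a * s ^ 2 + c))) = 3 * a * s * √(a * s ^ 2 + c) := by
    calc 2 * (a : ℝ) * s * √(a * s ^ 2 + c) + (a * s ^ 2 + c) * (2 * a * s / (2 * √(a * s ^ 2 + c)))
        = 2 * (a : ℝ) * s * √(a * s ^ 2 + c) +
            √(a * s ^ 2 + c) * √(a * s ^ 2 + c) * (2 * a * s / (2 * √(a * s ^ 2 + c))) := by
          rw [hsu]
      _ = 3 * a * s * √(a * s ^ 2 + c) := by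
          field_simp
          ring
  rw [← e]
  exact h

/-- `h` is continuous. [calculus] -/
theorem continuous_ph (a c : ℚ) : Continuous (ph a c) := by
  have hu : Continuous fun x : ℝ => (a : ℝ) * x ^ 2 + c := by continuity
  exact hu.mul hu.sqrt

/-- The `r`-primitive `P(t, r) = (γ/(3a))·h(r)/W(t)` of the pulled-back weight (`a ≠ 0`).
[this node] -/
def ppot (κ₀ κ₁ γ a c : ℚ) (p : Fin 2 → ℝ) : ℝ :=
  (γ : ℝ) / (3 * a) * ph a c (p 1) / (κ₀ + κ₁ * p 0 ^ 2)

/-- The fibre function of the primitive at base point `t`. [this node] -/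
def ppotFib (κ₀ κ₁ γ a c : ℚ) (t s : ℝ) : ℝ :=
  (γ : ℝ) / (3 * a) * ph a c s / (κ₀ + κ₁ * t ^ 2)

/-- Auxiliary step `ppot_eq`. [bookkeeping] -/
theorem ppot_eq (κ₀ κ₁ γ a c : ℚ) (p : Fin 2 → ℝ) :
    ppot κ₀ κ₁ γ a c p = ppotFib κ₀ κ₁ γ a c (p 0) (p 1) := rfl

/-- **Rule (3) input:** `∂P/∂r = γ r √(a r² + c)/W(t)` where `a r² + c > 0` (`a ≠ 0`).
[calculus; this node] -/
theorem hasDerivAt_ppotFib (hκ : 0 < κ₀ ∧ 0 ≤ κ₁) {γ a c : ℚ} (ha : a ≠ 0) (t : ℝ) {r : ℝ}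
    (hr : 0 < (a : ℝ) * r ^ 2 + c) :
    HasDerivAt (ppotFib κ₀ κ₁ γ a c t) (pweight κ₀ κ₁ γ a c ![t, r]) r := by
  have hW : (κ₀ : ℝ) + κ₁ * t ^ 2 ≠ 0 := (pW_pos hκ t).ne'
  have ha' : (a : ℝ) ≠ 0 := by exact_mod_cast ha
  have h := ((hasDerivAt_ph a c hr).const_mul ((γ : ℝ) / (3 * a))).div_const ((κ₀ : ℝ) + κ₁ * t ^ 2)
  have e : (γ : ℝ) / (3 * a) * (3 * a * r * √(a * r ^ 2 + c)) / (κ₀ + κ₁ * t ^ 2) =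
      pweight κ₀ κ₁ γ a c ![t, r] := by
    simp only [pweight, Matrix.cons_val_zero, Matrix.cons_val_one, Matrix.cons_val_fin_one]
    field_simp
  rw [← e]
  exact h

/-- `P` is continuous. [calculus] -/
theorem continuous_ppot (hκ : 0 < κ₀ ∧ 0 ≤ κ₁) (γ a c : ℚ) : Continuous (ppot κ₀ κ₁ γ a c) := by
  have h1 : Continuous fun p : Fin 2 → ℝ => p 1 := continuous_apply 1
  have h0 : Continuous fun p : Fin 2 → ℝ => p 0 := continuous_apply 0
  have hW : Continuous fun p : Fin 2 → ℝ => (κ₀ : ℝ) + κ₁ * p 0 ^ 2 := by continuity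
  exact ((continuous_const.mul ((continuous_ph a c).comp h1)).div hW
    fun p => (pW_pos hκ (p 0)).ne').congr fun p => rfl

/-- `P` is `ℚ`-semialgebraic on the whole plane. [BCR1998 §2.2] -/
theorem isSemialgebraicFunOn_ppot (hκ : 0 < κ₀ ∧ 0 ≤ κ₁) (γ a c : ℚ) :
    IsSemialgebraicFunOn ℚ univ (ppot κ₀ κ₁ γ a c) := by
  have hU : IsSemialgebraic ℚ (univ : Set (Fin 2 → ℝ)) := isSemialgebraic_univ
  have hnum : IsSemialgebraicFunOn ℚ univ fun p : Fin 2 → ℝ =>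
      (γ : ℝ) / (3 * a) * (((a : ℝ) * p 1 ^ 2 + c) * √(a * p 1 ^ 2 + c)) :=
    ((isSemialgebraicFunOn_aeval hU
        (C (γ / (3 * a)) * (C a * X 1 ^ 2 + C c) : MvPolynomial (Fin 2) ℚ)).mul_holds
      (IsSemialgebraicFunOn.sqrt_holds
        (isSemialgebraicFunOn_aeval hU (C a * X 1 ^ 2 + C c : MvPolynomial (Fin 2) ℚ)))).congr
      fun p _ => by
        simp
        ring
  have hden : IsSemialgebraicFunOn ℚ univ fun p : Fin 2 → ℝ => (κ₀ : ℝ) + κ₁ * p 0 ^ 2 :=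
    (isSemialgebraicFunOn_aeval hU (C κ₀ + C κ₁ * X 0 ^ 2 : MvPolynomial (Fin 2) ℚ)).congr
      fun p _ => by simp
  exact (hnum.div hden fun p _ => (pW_pos hκ (p 0)).ne').congr fun p _ => by
    simp only [ppot, ph]

/-- The fibrewise derivative of `P` in the engine's `Fin.snoc` form: on any set where
`a r² + c > 0`, `∂/∂s P(init z, s)|_{s = z 1} = pweight z`. [this node] -/
theorem hasDerivAt_ppot_snoc (hκ : 0 < κ₀ ∧ 0 ≤ κ₁) {γ a c : ℚ} (ha : a ≠ 0) (z : Fin 2 → ℝ)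
    (hz : 0 < (a : ℝ) * z 1 ^ 2 + c) :
    HasDerivAt (fun s : ℝ => ppot κ₀ κ₁ γ a c (Fin.snoc (Fin.init z) s))
      (pweight κ₀ κ₁ γ a c z) (z (Fin.last 1)) := by
  have e0 : ∀ s : ℝ, (Fin.snoc (Fin.init z) s : Fin 2 → ℝ) 0 = z 0 := fun s => by
    have : (0 : Fin 2) = Fin.castSucc (0 : Fin 1) := rfl
    rw [this, Fin.snoc_castSucc]
    rfl
  have e1 : ∀ s : ℝ, (Fin.snoc (Fin.init z) s : Fin 2 → ℝ) 1 = s := fun s => by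
    have : (1 : Fin 2) = Fin.last 1 := rfl
    rw [this, Fin.snoc_last]
  have hf : (fun s : ℝ => ppot κ₀ κ₁ γ a c (Fin.snoc (Fin.init z) s)) =
      ppotFib κ₀ κ₁ γ a c (z 0) := by
    funext s
    rw [ppot_eq, e0, e1]
  have hz' : pweight κ₀ κ₁ γ a c ![z 0, z 1] = pweight κ₀ κ₁ γ a c z := by
    simp only [pweight, Matrix.cons_val_zero, Matrix.cons_val_one, Matrix.cons_val_fin_one]
  rw [hf, show z (Fin.last 1) = z 1 from rfl, ← hz']
  exact hasDerivAt_ppotFib hκ ha (z 0) hz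

/-! #### 32.6 Rational affine maps of the plane (rule (2) with constant Jacobian) -/

/-- A rational affine map of the plane `p ↦ M p + c`. [this node] -/
structure AffMap where
  (m00 m01 m10 m11 c0 c1 : ℚ)

namespace AffMap

variable (M : AffMap)

/-- The map. [this node] -/
def toFun (p : Fin 2 → ℝ) : Fin 2 → ℝ :=
  ![M.m00 * p 0 + M.m01 * p 1 + M.c0, M.m10 * p 0 + M.m11 * p 1 + M.c1]

/-- Auxiliary step `toFun_zero`. [bookkeeping] -/
@[simp] theorem toFun_zero (p : Fin 2 → ℝ) : M.toFun p 0 = M.m00 * p 0 + M.m01 * p 1 + M.c0 := rfl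
/-- Auxiliary step `toFun_one`. [bookkeeping] -/
@[simp] theorem toFun_one (p : Fin 2 → ℝ) : M.toFun p 1 = M.m10 * p 0 + M.m11 * p 1 + M.c1 := rfl

/-- The determinant. [this node] -/
def det : ℚ := M.m00 * M.m11 - M.m01 * M.m10

/-- The linear part as a real matrix. [this node] -/
def mat : Matrix (Fin 2) (Fin 2) ℝ := !![(M.m00 : ℝ), M.m01; M.m10, M.m11]

/-- The (constant) derivative. [this node] -/
def deriv : (Fin 2 → ℝ) →L[ℝ] (Fin 2 → ℝ) := LinearMap.toContinuousLinearMap (Matrix.toLin' M.mat)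

/-- Auxiliary step `deriv_apply`. [bookkeeping] -/
theorem deriv_apply (v : Fin 2 → ℝ) :
    M.deriv v = ![(M.m00 : ℝ) * v 0 + M.m01 * v 1, M.m10 * v 0 + M.m11 * v 1] := by
  ext j
  fin_cases j <;> simp [deriv, mat, Matrix.mulVec, dotProduct, Fin.sum_univ_two]

/-- `det M′ = det M`. [folklore] -/
theorem deriv_det : M.deriv.det = (M.det : ℝ) := by
  have h : M.mat.det = (M.det : ℝ) := by
    simp [mat, Matrix.det_fin_two, det]
  rw [← h]
  exact LinearMap.det_toLin' _

/-- The map is differentiable with derivative `M′`. [folklore] -/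
theorem hasFDerivAt_toFun (y : Fin 2 → ℝ) : HasFDerivAt M.toFun M.deriv y := by
  have p : ∀ i : Fin 2, HasFDerivAt (fun z : Fin 2 → ℝ => z i)
      (ContinuousLinearMap.proj (R := ℝ) (φ := fun _ : Fin 2 => ℝ) i) y :=
    fun i => hasFDerivAt_apply i y
  have c0 : HasFDerivAt (fun z : Fin 2 → ℝ => M.toFun z 0)
      ((ContinuousLinearMap.proj 0).comp M.deriv) y := by
    have hfun : (fun z : Fin 2 → ℝ => M.toFun z 0) =
        fun z => (M.m00 : ℝ) * z 0 + M.m01 * z 1 + M.c0 := funext M.toFun_zero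
    rw [hfun]
    refine ((((p 0).const_mul (M.m00 : ℝ)).add ((p 1).const_mul (M.m01 : ℝ))).add_const
      (M.c0 : ℝ)).congr_fderiv ?_
    ext v
    simp [deriv_apply]
  have c1 : HasFDerivAt (fun z : Fin 2 → ℝ => M.toFun z 1)
      ((ContinuousLinearMap.proj 1).comp M.deriv) y := by
    have hfun : (fun z : Fin 2 → ℝ => M.toFun z 1) =
        fun z => (M.m10 : ℝ) * z 0 + M.m11 * z 1 + M.c1 := funext M.toFun_one
    rw [hfun]
    refine ((((p 0).const_mul (M.m10 : ℝ)).add ((p 1).const_mul (M.m11 : ℝ))).add_const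
      (M.c1 : ℝ)).congr_fderiv ?_
    ext v
    simp [deriv_apply]
  rw [hasFDerivAt_pi']
  intro i
  fin_cases i
  · exact c0
  · exact c1

/-- The inverse affine map (meaningful for `det M ≠ 0`). [this node] -/
def inv : AffMap :=
  ⟨M.m11 / M.det, -M.m01 / M.det, -M.m10 / M.det, M.m00 / M.det,
    -(M.m11 * M.c0 - M.m01 * M.c1) / M.det, -(M.m00 * M.c1 - M.m10 * M.c0) / M.det⟩

/-- Auxiliary step `det_cast`. [bookkeeping] -/
theorem det_cast : (M.m00 : ℝ) * M.m11 - M.m01 * M.m10 = (M.det : ℝ) := by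
  simp only [det]
  push_cast
  ring

/-- Auxiliary step `inv_toFun`. [bookkeeping] -/
theorem inv_toFun (hdet : M.det ≠ 0) (p : Fin 2 → ℝ) : M.inv.toFun (M.toFun p) = p := by
  have hd : (M.det : ℝ) ≠ 0 := by exact_mod_cast hdet
  funext j
  fin_cases j
  · simp only [inv, toFun_zero, toFun_one, Rat.cast_div, Rat.cast_neg, Rat.cast_sub,
      Rat.cast_mul, Fin.zero_eta]
    field_simp
    rw [← det_cast]
    ring
  · simp only [inv, toFun_zero, toFun_one, Rat.cast_div, Rat.cast_neg, Rat.cast_sub,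
      Rat.cast_mul, Fin.mk_one]
    field_simp
    rw [← det_cast]
    ring

/-- Auxiliary step `toFun_inv`. [bookkeeping] -/
theorem toFun_inv (hdet : M.det ≠ 0) (w : Fin 2 → ℝ) : M.toFun (M.inv.toFun w) = w := by
  have hd : (M.det : ℝ) ≠ 0 := by exact_mod_cast hdet
  funext j
  fin_cases j
  · simp only [inv, toFun_zero, toFun_one, Rat.cast_div, Rat.cast_neg, Rat.cast_sub,
      Rat.cast_mul, Fin.zero_eta]
    field_simp
    rw [← det_cast]
    ring
  · simp only [inv, toFun_zero, toFun_one, Rat.cast_div, Rat.cast_neg, Rat.cast_sub,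
      Rat.cast_mul, Fin.mk_one]
    field_simp
    rw [← det_cast]
    ring

/-- The map is injective for `det M ≠ 0`. [folklore] -/
theorem injective_toFun (hdet : M.det ≠ 0) : Function.Injective M.toFun := fun p q h => by
  rw [← M.inv_toFun hdet p, ← M.inv_toFun hdet q, h]

/-- The image of a set. [this node] -/
theorem image_toFun (hdet : M.det ≠ 0) (S : Set (Fin 2 → ℝ)) :
    M.toFun '' S = {w | M.inv.toFun w ∈ S} := by
  ext w
  constructor
  · rintro ⟨p, hp, rfl⟩
    show M.inv.toFun (M.toFun p) ∈ S
    rwa [M.inv_toFun hdet]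
  · intro hw
    exact ⟨M.inv.toFun w, hw, M.toFun_inv hdet w⟩

/-- The map is `ℚ`-semialgebraic (affine with rational coefficients). [BCR1998 §2.2] -/
theorem isSemialgebraicMapOn_toFun {s : Set (Fin 2 → ℝ)} (hs : IsSemialgebraic ℚ s) :
    IsSemialgebraicMapOn ℚ s M.toFun := by
  refine IsSemialgebraicMapOn.of_forall hs fun j => ?_
  fin_cases j
  · exact (isSemialgebraicFunOn_aeval hs
      (C M.m00 * X 0 + C M.m01 * X 1 + C M.c0 : MvPolynomial (Fin 2) ℚ)).congr fun y _ => by simp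
  · exact (isSemialgebraicFunOn_aeval hs
      (C M.m10 * X 0 + C M.m11 * X 1 + C M.c1 : MvPolynomial (Fin 2) ℚ)).congr fun y _ => by simp

/-- **A rational affine map as one move of rule (2).** [KontsevichZagier2001 §1.2 rule (2)] -/
theorem sub_mem_relations (hdet : M.det ≠ 0) (ρ σ : KZ.IntegralRep 2)
    (hσ : σ.domain = M.toFun '' ρ.domain)
    (hf : ∀ p ∈ ρ.domain, ρ.integrand p = σ.integrand (M.toFun p) * |(M.det : ℝ)|) :
    KZ.of ρ - KZ.of σ ∈ KZ.relations := by
  refine KZ.changeOfVariablesRel_subset_relations ⟨2, ρ, σ, M.toFun, fun _ => M.deriv,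
    M.isSemialgebraicMapOn_toFun ρ.isSemialgebraic_domain,
    fun p _ => (M.hasFDerivAt_toFun p).hasFDerivWithinAt, (M.injective_toFun hdet).injOn, hσ,
    ?_, rfl⟩
  intro p hp
  rw [hf p hp, deriv_det]

/-- Transfer along an affine map. [this node] -/
theorem inBaker_of (hdet : M.det ≠ 0) (ρ σ : KZ.IntegralRep 2)
    (hσ : σ.domain = M.toFun '' ρ.domain)
    (hf : ∀ p ∈ ρ.domain, ρ.integrand p = σ.integrand (M.toFun p) * |(M.det : ℝ)|)
    (h : InBaker (KZ.of ρ)) : InBaker (KZ.of σ) := by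
  refine h.congr ?_
  rw [← neg_sub]
  exact KZ.relations.neg_mem (M.sub_mem_relations hdet ρ σ hσ hf)

/-- Transfer back along an affine map. [this node] -/
theorem inBaker_to (hdet : M.det ≠ 0) (ρ σ : KZ.IntegralRep 2)
    (hσ : σ.domain = M.toFun '' ρ.domain)
    (hf : ∀ p ∈ ρ.domain, ρ.integrand p = σ.integrand (M.toFun p) * |(M.det : ℝ)|)
    (h : InBaker (KZ.of σ)) : InBaker (KZ.of ρ) :=
  h.congr (M.sub_mem_relations hdet ρ σ hσ hf)

end AffMap

end Summit.KontsevichZagierPeriods.RootDecompWalshStrata.ConicDescent.BallCube
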